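import Summits.HodgeConjecture.HodgeConjecture.Theorems.R90S5ThetaOfRecordDefs             -- ★ (this seat) `IsThetaMemberAt`, `IsThetaOfRecord` — the characters `νᵢ`, `χ₁` of its two clauses
import Literature.NumberTheory.GaloisRepresentations.HeckeCharacterNormCharacter           -- ★ `HeckeCharacter.IsUnitary.mul ∕ .inv`
import Literature.NumberTheory.Automorphic.HeckeCharacterLocalComponentSmooth              -- ★ `HeckeCharacter.continuous_localComponent`
import HarnessLib

/-!
# R90-TF · S5 — THE LOCAL DATA OF `IsThetaMemberAt` ARE UNITARY AND CONTINUOUS (the consumer obligations of the (T′)-local lemmas at p03's (T′) pay)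
# (`Theorems/R90S5ThetaMemberLocalData.lean`; seat R90-C133-p03 (g0); R90-C133-plan (g0) 16:29:08Z «the consumer obligations (`νᵢ` unitary∕continuous for
# `((pullback θᵢ)·μω⁻¹).localComponent w`) are p03's at (T′)»)

Cell `hodgecm-mathlib`, crux H413 (`stmt-HodgeConjecture-24833`); programme R90-TF, section S5.  PROOF lane (`--supports stmt-HodgeConjecture-24833 --as helper`): theorems only, no
`def`, no instance, no notation, no `sorry`.  The (T′) law «a one-dimensional `ξ`'s U(2)-block is never ★ `R90.S5.IsThetaOfRecord`» is paid (S5 C ED. 4 `stub_R90_S5_oneDim_notTheta`)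
from the LOCAL lemmas of R90-C14-p03 (split half, DEAL #17: `not_isConstituentOf_parabolicIndGL_two_of_finrank_eq_one`, hypothesis-first UNITARY + CONTINUOUS `νᵢ`) and R90-C14-p02
(non-split half, DEAL #17b); those lemmas bind the inducing characters abstractly, and THIS file discharges their side conditions for the characters ★ `IsThetaMemberAt` actually uses:
* §1 `isUnitary_torusPullback` — the base change `TorusDict.pullback c̄ … θ hθ` of ANY automorphic character `θ` of `U(1)` is a UNITARY Hecke character (★
  `UnitaryGroup.norm_torusHom_apply_eq_one_of_isAutomorphic`: `θ` descends to the compact `T(L⁺)\T(𝔸_{L⁺})`; = ★ `OneDimAutRepH.isUnitary_bcη` for a general `θ`);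
  `isUnitary_torusPullback_mul_inv` — so is `(pullback θ) · μω⁻¹` for unitary `μω`.
* §2 SPLIT data: `norm_thetaSplitChar_apply`, `continuous_thetaSplitChar` — `ν := ((pullback θ) · μω⁻¹).localComponent w` has `‖ν a‖ = 1` and is continuous
  (★ `HeckeCharacter.localComponent_apply`, ★ `continuous_localComponent`) — the hypotheses of the split (T′)-lemma at `ν₁, ν₃`.
* §3 NON-SPLIT data: `norm_thetaSemilocalChar_apply`, `continuous_thetaSemilocalChar` — `χ₁ := ((pullback θ) · μω⁻¹).semilocalComponent L v` likewise (★ `semilocalComponent_apply`,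
  ★ `continuous_semilocalComponent`).
HONEST LABEL: bookkeeping; closes nothing; REL ≠ ★ ≠ BUILT; HC_CM is proved only modulo the 7 printed citations (2 remaining named inputs: hLiu418 = stmt-HodgeConjecture-24832,
h413 = stmt-HodgeConjecture-24833) until rung 0 closes.
[cite: Rogawski1990, §11.4 Prop. 11.4.1 (a) p. 166; §12.2 p. 174] [cite: Godement1964, §5 Thm. 4] [cite: TateThesis1967, §4.3]
-/

set_option autoImplicit false
-- the mandated namespace repeats the single-problem summit's segment (`HodgeConjecture.HodgeConjecture`)
set_option linter.dupNamespace false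

noncomputable section

open NumberField IsDedekindDomain
open Literature.NumberTheory.GaloisRepresentations
open Literature.NumberTheory.Automorphic Literature.NumberTheory.Automorphic.UnitaryGroup
open Literature.NumberTheory.Automorphic.Arthur2013.Leaves.TECR

namespace Summit.HodgeConjecture.HodgeConjecture.R90.S5

variable (L : Type) [Field L] [NumberField L] [IsCMField L]

/-! ## §1 The base change of an automorphic character of `U(1)` is unitary -/

/-- **`θ̃ = TorusDict.pullback … θ hθ` IS UNITARY** for every automorphic character `θ` of `U(1) = T` (continuous character of `T(𝔸_{L⁺})` trivial on `T(L⁺)`): `‖θ̃ z‖ = ‖θ (c̄•z ∕ z)‖ = 1`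
since `θ` descends to the COMPACT quotient `T(L⁺)\T(𝔸_{L⁺})` (★ `norm_torusHom_apply_eq_one_of_isAutomorphic`).  (★ `OneDimAutRepH.isUnitary_bcη` is the case `θ = ξ.η`.)
[cite: Godement1964, §5 Thm. 4] [cite: Rogawski1990, §12.2 p. 174] -/
theorem isUnitary_torusPullback (θ : ↥(TorusDict.torus (IsCMField.complexConj L)) →ₜ* ℂˣ) (hθ : TorusDict.IsAutomorphic (IsCMField.complexConj L) θ) :
    (TorusDict.pullback (IsCMField.complexConj L) (Algebra.IsQuadraticExtension.finrank_eq_two _ L) (IsCMField.complexConj_ne_one (K := L)) θ hθ).IsUnitary :=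
  fun _ => UnitaryGroup.norm_torusHom_apply_eq_one_of_isAutomorphic _ L _ (Algebra.IsQuadraticExtension.finrank_eq_two _ L)
    (IsCMField.complexConj_ne_one (K := L)) θ hθ _

/-- **`θ̃ · μ⁻¹` is unitary** for unitary `μ = μω` (★ `IsUnitary.mul`, ★ `IsUnitary.inv`) — the Hecke character whose local components are the data of ★ `IsThetaMemberAt`.
[cite: Godement1964, §5 Thm. 4] [cite: Rogawski1990, §11.4 Prop. 11.4.1 (a) p. 166] -/
theorem isUnitary_torusPullback_mul_inv (θ : ↥(TorusDict.torus (IsCMField.complexConj L)) →ₜ* ℂˣ) (hθ : TorusDict.IsAutomorphic (IsCMField.complexConj L) θ)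
    {μω : HeckeCharacter L} (hμu : μω.IsUnitary) :
    (TorusDict.pullback (IsCMField.complexConj L) (Algebra.IsQuadraticExtension.finrank_eq_two _ L) (IsCMField.complexConj_ne_one (K := L)) θ hθ * μω⁻¹).IsUnitary :=
  (isUnitary_torusPullback L θ hθ).mul hμu.inv

/-! ## §2 SPLIT data: the characters `νᵢ = ((pullback θᵢ) · μω⁻¹)_w` of `L_wˣ` are unitary and continuous -/

/-- **`‖ν a‖ = 1`** for `ν := ((pullback θ) · μω⁻¹).localComponent w`, `θ` automorphic, `μω` unitary — the unitarity hypothesis of the split (T′)-lemma at the characters of ★ `IsThetaMemberAt`'s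
split clause. [cite: Godement1964, §5 Thm. 4] [cite: Rogawski1990, §11.4 Prop. 11.4.1 (a) p. 166] -/
theorem norm_thetaSplitChar_apply (θ : ↥(TorusDict.torus (IsCMField.complexConj L)) →ₜ* ℂˣ) (hθ : TorusDict.IsAutomorphic (IsCMField.complexConj L) θ)
    {μω : HeckeCharacter L} (hμu : μω.IsUnitary) (w : HeightOneSpectrum (𝓞 L)) (a : (w.adicCompletion L)ˣ) :
    ‖(((TorusDict.pullback (IsCMField.complexConj L) (Algebra.IsQuadraticExtension.finrank_eq_two _ L) (IsCMField.complexConj_ne_one (K := L)) θ hθ * μω⁻¹).localComponent w a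
      : ℂˣ) : ℂ)‖ = 1 := by
  rw [HeckeCharacter.localComponent_apply]
  exact isUnitary_torusPullback_mul_inv L θ hθ hμu _

/-- **`ν` is continuous** (★ `HeckeCharacter.continuous_localComponent`). [cite: TateThesis1967, §4.3] -/
theorem continuous_thetaSplitChar (θ : ↥(TorusDict.torus (IsCMField.complexConj L)) →ₜ* ℂˣ) (hθ : TorusDict.IsAutomorphic (IsCMField.complexConj L) θ)
    (μω : HeckeCharacter L) (w : HeightOneSpectrum (𝓞 L)) :
    Continuous fun a : (w.adicCompletion L)ˣ =>
      (((TorusDict.pullback (IsCMField.complexConj L) (Algebra.IsQuadraticExtension.finrank_eq_two _ L) (IsCMField.complexConj_ne_one (K := L)) θ hθ * μω⁻¹).localComponent w a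
        : ℂˣ) : ℂ) :=
  Units.continuous_val.comp ((TorusDict.pullback (IsCMField.complexConj L) (Algebra.IsQuadraticExtension.finrank_eq_two _ L) (IsCMField.complexConj_ne_one (K := L)) θ hθ *
    μω⁻¹).continuous_localComponent w)

/-! ## §3 NON-SPLIT data: the character `χ₁ = ((pullback θ) · μω⁻¹)_v` of `(L ⊗ L⁺_v)ˣ` is unitary and continuous -/

/-- **`‖χ₁ u‖ = 1`** for `χ₁ := ((pullback θ) · μω⁻¹).semilocalComponent L v` (★ `semilocalComponent_apply`) — the unitarity hypothesis of the non-split (T′)-lemma at the character of ★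
`IsThetaMemberAt`'s non-split clause. [cite: Godement1964, §5 Thm. 4] [cite: Rogawski1990, §11.1 Prop. 11.1.1 (c) p. 163] -/
theorem norm_thetaSemilocalChar_apply (θ : ↥(TorusDict.torus (IsCMField.complexConj L)) →ₜ* ℂˣ) (hθ : TorusDict.IsAutomorphic (IsCMField.complexConj L) θ)
    {μω : HeckeCharacter L} (hμu : μω.IsUnitary) (v : HeightOneSpectrum (𝓞 ↥(maximalRealSubfield L))) (u : (LocalRing L v)ˣ) :
    ‖(((TorusDict.pullback (IsCMField.complexConj L) (Algebra.IsQuadraticExtension.finrank_eq_two _ L) (IsCMField.complexConj_ne_one (K := L)) θ hθ * μω⁻¹).semilocalComponent L v u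
      : ℂˣ) : ℂ)‖ = 1 := by
  rw [UnitaryGroup.semilocalComponent_apply]
  exact isUnitary_torusPullback_mul_inv L θ hθ hμu _

/-- **`χ₁` is continuous** (★ `continuous_semilocalComponent`). [cite: TateThesis1967, §4.3] -/
theorem continuous_thetaSemilocalChar (θ : ↥(TorusDict.torus (IsCMField.complexConj L)) →ₜ* ℂˣ) (hθ : TorusDict.IsAutomorphic (IsCMField.complexConj L) θ)
    (μω : HeckeCharacter L) (v : HeightOneSpectrum (𝓞 ↥(maximalRealSubfield L))) :
    Continuous ((TorusDict.pullback (IsCMField.complexConj L) (Algebra.IsQuadraticExtension.finrank_eq_two _ L) (IsCMField.complexConj_ne_one (K := L)) θ hθ *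
      μω⁻¹).semilocalComponent L v) :=
  UnitaryGroup.continuous_semilocalComponent (E := L) (v := v) _

end Summit.HodgeConjecture.HodgeConjecture.R90.S5

end
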